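import Summits.QuantumFields.YangMills.Theorems.CurvaturePoincareBoxUhlenbeck
import HarnessLib

/-!
# THE BOX UHLENBECK GAUGE WITH A CO-OPTIMISED ROOT: one root serves the `ℓ²` bound AND any second non-negative functional, at the price of a factor `2`
# (crux `FluctuationComparisonRegPrIntL`, stmt-QuantumFields-20520; registry v11.4 `Cruxes/FluctuationComparisonRegPrIntL/Lines/semiclassical_s2beta.lean` 3732b7df FROZEN, untouched)

Cell `ym3-torus` (YM ladder rung R3 = continuum `SU(2)` Yang–Mills on the three-torus — a RUNG: NOT d = 4, NOT infinite volume, NOT a mass gap, NOT Clay).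
Width seat `ym3-torus-px12` (gen 22); `--kind proof --supports stmt-QuantumFields-20520 --as helper`, count-neutral, DEFINITION-FREE (0 `def`, 0 `instance`,
0 `notation`, 0 `sorry`, default heartbeats).

WHY.  px19 g9's box Uhlenbeck lemma (✓`CurvaturePoincareBoxUhlenbeck.exists_gauge_sum_sq_le`, the gauge of ✓p811720 (6)) is ONE axial tree gauge whose ROOT is chosen among the `n` roots
`lo + r·e₀` of the box's bottom edge by pigeonhole on the `ℓ²` sum (`Σ_r D_r ≤ n·(3n)²·Σ_p`).  The inter-block («mean part») step of the road to the depth-uniform flat letter `hFlat` (HOME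
note `ym3-torus-px12/g22/HFLAT-ROAD-AFTER-6.px12g22.md` §5; instr1 g14 FL-27 (4): a FIXED tree's through-face transporters carry a `log n`, the `n` candidate trunks together form a sheet)
wants the root to be chosen well for a SECOND functional `Φ(r)` at the same time.  Two-functional pigeonhole: some root has BOTH `D_r ≤ 2·(3n)²·Σ_p` and `n·Φ(r) ≤ 2·Σ_{r′<n} Φ(r′)`.

WHAT.  §1 ★ `exists_lt_and_le_two_mul` — the generic two-functional pigeonhole over `range n`.  §2 ★★ `exists_root_gauge_sum_sq_le_and` — px19's theorem re-run with the root EXPOSED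
(`g (castSite x) = axialFn (pull U) (lo + r•e₀) x` on the box) and co-optimised against an arbitrary non-negative `Φ : ℕ → ℝ`.

HONEST: bookkeeping over px19's landed per-root bound `sum_sq_le_of_root` and line-sum injections; the functional `Φ` is a free binder (no mean-part letter is proved here); nothing of Bałaban's
analysis; hFlat, TUBE-REG∘, GAP♯∘, EXW∘, S2β, crux 20520 NOT proved; no registered stub is closed; rung R3 = SU(2) YM₃ on T³ — NOT d = 4, NOT infinite volume, NOT a mass gap, NOT Clay;
the Yang–Mills mass gap is NOT proved.  Sorry-free, axioms standard.

References: K. Uhlenbeck, CMP **83** (1982) 31–42 [Uhlenbeck1982]; T. Bałaban, CMP **98** (1985) 17–51 [Balaban1985Averaging] (pp.24–25); CMP **99** (1985) 75–102 [Balaban1985RegularSpaces] (Lemma 1 p.79).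
-/

set_option autoImplicit false

open scoped BigOperators
open Literature.MathematicalPhysics.QuantumFieldTheory.Balaban1983to89
open Literature.MathematicalPhysics.QuantumFieldTheory.Balaban1983to89.T3ContinuumYM3Torus
open Literature.MathematicalPhysics.QuantumFieldTheory.Balaban1983to89.T4AxialGaugeSmallField
  (boxPlaqs castSite castSite_apply pull pull_apply)
open Literature.MathematicalPhysics.QuantumFieldTheory.Balaban1983to89.B7Prop1Explicit
  (e e_apply hol gaugeAct plaqWord axialFn)
open Summit.QuantumFields.YangMills.Theorems.CurvaturePoincareBoxBonds (exists_rooted_gauge)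
open Summit.QuantumFields.YangMills.Theorems.CurvaturePoincareBoxLineSums (lineSum01_le_boxSum lineSum12_le_boxSum lineSum02_le_boxSum)
open Summit.QuantumFields.YangMills.Theorems.CurvaturePoincareBoxUhlenbeck (sum_sq_le_of_root avg_arith)

namespace Summit.QuantumFields.YangMills.Theorems.FluctuationComparisonRegPrIntLS2BetaBoxGaugeCoOptimisedRoot

/-! ## §1 Two-functional pigeonhole -/

/-- ★ **TWO-FUNCTIONAL PIGEONHOLE**: for non-negative `f, φ` on `range n` (`n ≥ 1`) with `Σ f ≤ n·A`, some index has BOTH `f r ≤ 2A` and `n·φ r ≤ 2·Σ φ`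
(at most half the indices violate each). [folklore] -/
theorem exists_lt_and_le_two_mul {n : ℕ} (hn : 0 < n) {f φ : ℕ → ℝ} (hf : ∀ r, 0 ≤ f r) (hφ : ∀ r, 0 ≤ φ r) {A : ℝ}
    (hA : ∑ r ∈ Finset.range n, f r ≤ (n : ℝ) * A) :
    ∃ r, r < n ∧ f r ≤ 2 * A ∧ (n : ℝ) * φ r ≤ 2 * ∑ r' ∈ Finset.range n, φ r' := by
  have hne : (Finset.range n).Nonempty := Finset.nonempty_range_iff.2 hn.ne'
  have hn0 : (0 : ℝ) < n := by exact_mod_cast hn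
  set B := ∑ r' ∈ Finset.range n, φ r' with hB
  have hB0 : 0 ≤ B := Finset.sum_nonneg fun r _ => hφ r
  have hSf0 : 0 ≤ ∑ r ∈ Finset.range n, f r := Finset.sum_nonneg fun r _ => hf r
  have hA0 : 0 ≤ A := by nlinarith
  -- single pigeonholes
  have hφ1 : ∃ r ∈ Finset.range n, φ r ≤ B / n := by
    refine Finset.exists_le_of_sum_le hne ?_
    rw [Finset.sum_const, Finset.card_range, nsmul_eq_mul, mul_div_cancel₀ _ hn0.ne']
  have hf1 : ∃ r ∈ Finset.range n, f r ≤ A := by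
    refine Finset.exists_le_of_sum_le hne ?_
    rw [Finset.sum_const, Finset.card_range, nsmul_eq_mul]
    exact hA
  rcases eq_or_lt_of_le hA0 with hAz | hApos
  · -- `A = 0`: every `f r = 0`
    obtain ⟨r, hr, hφr⟩ := hφ1
    have hfr : f r = 0 := by
      have hle : f r ≤ ∑ r ∈ Finset.range n, f r := Finset.single_le_sum (fun r _ => hf r) hr
      have : ∑ r ∈ Finset.range n, f r ≤ 0 := by rw [← hAz, mul_zero] at hA; exact hA
      linarith [hf r]
    refine ⟨r, Finset.mem_range.1 hr, by rw [hfr, ← hAz]; norm_num, ?_⟩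
    rw [le_div_iff₀ hn0] at hφr
    linarith
  rcases eq_or_lt_of_le hB0 with hBz | hBpos
  · -- `B = 0`: every `φ r = 0`
    obtain ⟨r, hr, hfr⟩ := hf1
    have hφr : φ r = 0 := by
      have hle : φ r ≤ B := Finset.single_le_sum (fun r _ => hφ r) hr
      linarith [hφ r]
    exact ⟨r, Finset.mem_range.1 hr, by linarith, by rw [hφr, mul_zero]; linarith⟩
  -- main case: a weighted sum
  by_contra hcon
  have hall : ∀ r ∈ Finset.range n, 2 * A * B < B * f r + A * ((n : ℝ) * φ r) := by
    intro r hr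
    have hr' := Finset.mem_range.1 hr
    by_cases h1 : f r ≤ 2 * A
    · have h2 : ¬ ((n : ℝ) * φ r ≤ 2 * B) := fun h2 => hcon ⟨r, hr', h1, h2⟩
      rw [not_le] at h2
      nlinarith [hf r, hφ r]
    · rw [not_le] at h1
      nlinarith [hf r, hφ r]
  have hlt : ∑ r ∈ Finset.range n, 2 * A * B < ∑ r ∈ Finset.range n, (B * f r + A * ((n : ℝ) * φ r)) := Finset.sum_lt_sum_of_nonempty hne hall
  rw [Finset.sum_const, Finset.card_range, nsmul_eq_mul, Finset.sum_add_distrib, ← Finset.mul_sum, ← Finset.mul_sum, ← Finset.mul_sum] at hlt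
  have h3 : B * ∑ r ∈ Finset.range n, f r ≤ B * ((n : ℝ) * A) := mul_le_mul_of_nonneg_left hA hB0
  nlinarith

/-! ## §2 The box gauge with a co-optimised root -/

section Member

variable (F : T3Family) (K : ℕ) {G : Type*} [GaugeGroup G]

/-- ★★ **THE BOX UHLENBECK GAUGE WITH A CO-OPTIMISED ROOT**: for every box of side `n` at `x₀` (`1 ≤ n`, `2n ≤ sitesPerDir 0`), every configuration `U` and every non-negative `Φ : ℕ → ℝ`
there is a root `r < n` and a gauge transformation `g` EQUAL ON THE BOX to the axial gauge rooted at `lo + r·e₀` (`lo = x₀.val`) with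
`Σ_{box bonds} dist₁((U^g)_b)² ≤ 2·(3n)²·Σ_{p ∈ boxPlaqs} dist₁(U(∂p))²` AND `n·Φ(r) ≤ 2·Σ_{r′<n} Φ(r′)` (px19's averaged-root argument, two-functional pigeonhole). [folklore] -/
theorem exists_root_gauge_sum_sq_le_and (U : GaugeField (F.P K) 0 G) {n : ℕ} (hn : 1 ≤ n) (h2n : 2 * n ≤ (F.P K).sitesPerDir 0)
    (x₀ : Site (F.P K) 0) (Φ : ℕ → ℝ) (hΦ : ∀ r, 0 ≤ Φ r) :
    open Classical in
    ∃ r, r < n ∧ ∃ g : GaugeTransf (F.P K) 0 G,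
      (∀ x, (fun k => ((x₀ k).val : ℤ)) ≤ x → x ≤ (fun k => ((x₀ k).val : ℤ) + ((n - 1 : ℕ) : ℤ)) →
        g (castSite x) = axialFn (pull U) ((fun k => ((x₀ k).val : ℤ)) + (r : ℤ) • e 0) x) ∧
      (∑ b ∈ Finset.univ.filter (fun b : PBond (F.P K) 0 => (∀ k, (b.src k - x₀ k).val < n) ∧ (∀ k, (b.tgt k - x₀ k).val < n)),
          dist1 (GaugeField.gaugeAct g U b) ^ 2) ≤
        2 * ((3 * (n : ℝ)) ^ 2 * (∑ p ∈ Finset.univ.filter (fun p : Plaq (F.P K) 0 => p ∈ boxPlaqs (P := F.P K) (j := 0)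
          (fun k => ((x₀ k).val : ℤ)) (fun k => ((x₀ k).val : ℤ) + ((n : ℤ) - 1))), dist1 (GaugeField.plaqHol U p) ^ 2)) ∧
      (n : ℝ) * Φ r ≤ 2 * ∑ r' ∈ Finset.range n, Φ r' := by
  classical
  set lo : Fin (F.P K).d → ℤ := fun k => ((x₀ k).val : ℤ) with hlo
  set N := n - 1 with hN
  have hNn : ∀ κ, (fun k => ((x₀ k).val : ℤ) + ((n - 1 : ℕ) : ℤ)) κ - lo κ < (F.P K).sitesPerDir 0 := fun κ => by
    show ((x₀ κ).val : ℤ) + ((n - 1 : ℕ) : ℤ) - lo κ < ((F.P K).sitesPerDir 0 : ℤ)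
    simp only [hlo]
    omega
  have hex : ∀ r : ℕ, ∃ g : GaugeTransf (F.P K) 0 G, ∀ x, lo ≤ x → x ≤ (fun k => ((x₀ k).val : ℤ) + ((n - 1 : ℕ) : ℤ)) →
      g (castSite x) = axialFn (pull U) (lo + (r : ℤ) • e 0) x := fun r => exists_rooted_gauge F K U hNn _
  choose g hg using hex
  set SF := ∑ p ∈ Finset.univ.filter (fun p : Plaq (F.P K) 0 => p ∈ boxPlaqs (P := F.P K) (j := 0)
    (fun k => ((x₀ k).val : ℤ)) (fun k => ((x₀ k).val : ℤ) + ((n : ℤ) - 1))), dist1 (GaugeField.plaqHol U p) ^ 2 with hSF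
  set S01 := ∑ v₁ ∈ Finset.range N, ∑ v₂ ∈ Finset.range n, ∑ t ∈ Finset.range N,
    dist1 (hol (pull U) (lo + (t : ℤ) • e 0 + (v₁ : ℤ) • e 1 + (v₂ : ℤ) • e 2) (plaqWord 0 1)) ^ 2 with hS01
  set S12 : ℕ → ℝ := fun r => ∑ v₂ ∈ Finset.range N, ∑ s ∈ Finset.range N,
    dist1 (hol (pull U) (lo + (r : ℤ) • e 0 + (s : ℤ) • e 1 + (v₂ : ℤ) • e 2) (plaqWord 1 2)) ^ 2 with hS12
  set S02 := ∑ v₁ ∈ Finset.range n, ∑ v₂ ∈ Finset.range N, ∑ t ∈ Finset.range N,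
    dist1 (hol (pull U) (lo + (t : ℤ) • e 0 + (v₁ : ℤ) • e 1 + (v₂ : ℤ) • e 2) (plaqWord 0 2)) ^ 2 with hS02
  have h01 : S01 ≤ SF := lineSum01_le_boxSum F K U hn h2n x₀
  have h12 : ∑ r ∈ Finset.range n, S12 r ≤ SF := lineSum12_le_boxSum F K U hn h2n x₀
  have h02 : S02 ≤ SF := lineSum02_le_boxSum F K U hn h2n x₀
  have hSFnn : 0 ≤ SF := Finset.sum_nonneg fun _ _ => sq_nonneg _
  have hD : ∀ r ∈ Finset.range n,
      (∑ b ∈ Finset.univ.filter (fun b : PBond (F.P K) 0 => (∀ k, (b.src k - x₀ k).val < n) ∧ (∀ k, (b.tgt k - x₀ k).val < n)),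
          dist1 (GaugeField.gaugeAct (g r) U b) ^ 2) ≤
        (n : ℝ) * (N : ℝ) * S01 + 2 * (N : ℝ) * ((n : ℝ) * (n : ℝ) * S12 r + (n : ℝ) * S02) := fun r hr =>
    sum_sq_le_of_root F K U hn h2n x₀ (by rw [Finset.mem_range] at hr; omega) (g r) (hg r)
  clear_value S01 S12 S02
  have hsplit : ∀ r : ℕ, (n : ℝ) * (N : ℝ) * S01 + 2 * (N : ℝ) * ((n : ℝ) * (n : ℝ) * S12 r + (n : ℝ) * S02) =
      (n : ℝ) * (N : ℝ) * S01 + (2 * (N : ℝ) * ((n : ℝ) * (n : ℝ))) * S12 r + 2 * (N : ℝ) * ((n : ℝ) * S02) := fun r => by ring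
  have hsum : (∑ r ∈ Finset.range n, ∑ b ∈ Finset.univ.filter (fun b : PBond (F.P K) 0 =>
        (∀ k, (b.src k - x₀ k).val < n) ∧ (∀ k, (b.tgt k - x₀ k).val < n)), dist1 (GaugeField.gaugeAct (g r) U b) ^ 2) ≤
      (n : ℝ) * ((3 * (n : ℝ)) ^ 2 * SF) := by
    calc (∑ r ∈ Finset.range n, ∑ b ∈ Finset.univ.filter (fun b : PBond (F.P K) 0 =>
            (∀ k, (b.src k - x₀ k).val < n) ∧ (∀ k, (b.tgt k - x₀ k).val < n)), dist1 (GaugeField.gaugeAct (g r) U b) ^ 2)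
        ≤ ∑ r ∈ Finset.range n, ((n : ℝ) * (N : ℝ) * S01 + 2 * (N : ℝ) * ((n : ℝ) * (n : ℝ) * S12 r + (n : ℝ) * S02)) :=
          Finset.sum_le_sum hD
      _ = (n : ℝ) * ((n : ℝ) * (N : ℝ) * S01) + 2 * (N : ℝ) * ((n : ℝ) * (n : ℝ)) * (∑ r ∈ Finset.range n, S12 r) +
            (n : ℝ) * (2 * (N : ℝ) * ((n : ℝ) * S02)) := by
          simp only [hsplit, Finset.sum_add_distrib, Finset.sum_const, Finset.card_range, nsmul_eq_mul, ← Finset.mul_sum]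
      _ ≤ (n : ℝ) * ((3 * (n : ℝ)) ^ 2 * SF) := avg_arith (Nat.sub_le n 1) hSFnn h01 h12 h02
  obtain ⟨r, hr, hDr, hΦr⟩ := exists_lt_and_le_two_mul (f := fun r => ∑ b ∈ Finset.univ.filter (fun b : PBond (F.P K) 0 =>
        (∀ k, (b.src k - x₀ k).val < n) ∧ (∀ k, (b.tgt k - x₀ k).val < n)), dist1 (GaugeField.gaugeAct (g r) U b) ^ 2)
    (by omega) (fun r => Finset.sum_nonneg fun _ _ => sq_nonneg _) hΦ hsum
  exact ⟨r, hr, g r, hg r, hDr, hΦr⟩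

end Member

end Summit.QuantumFields.YangMills.Theorems.FluctuationComparisonRegPrIntLS2BetaBoxGaugeCoOptimisedRoot
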